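import Summits.ResolutionOfSingularities.ResolutionOfSingularities.Theorems.PurelyInseparableDim4ResConeLayerBirths
import Summits.ResolutionOfSingularities.ResolutionOfSingularities.Theorems.PurelyInseparableDim4ResConePowerCone
import Summits.ResolutionOfSingularities.ResolutionOfSingularities.Theorems.PurelyInseparableDim4ResConeFormPersist
import Summits.ResolutionOfSingularities.ResolutionOfSingularities.Theorems.PurelyInseparableDim4ResConeVertexDrop
import HarnessLib
import HarnessLib.Audit.Tags

/-!
# Purely inseparable four-folds — SLICE B: the TILT of the persisting contact form on a power-cone step is
# read off the first birth layer (cell `res-dim4-pi`, K2(p) lane, slice B (B3′))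

[OURS · counted 0 · cell `res-dim4-pi` · K2(p) lane, SLICE B architecture (B3′) (holder res-dim4-p-12 g3, bus
2026-08-28T22:48Z).]  Nothing here proves K2(p), `NoIsolatedTrap p p` or resolution of singularities in dimension
≥ 4 / characteristic `p`.  AI kernel work, weaker than expert review.

SLICE B of K2(p) (`…ResConeTameSlices`): an isolated above-floor chain of constant shade `1 ≤ d < p` whose
residual cones are POWER CONES `g_k = a_k · ℓ_k^d` (`e_G ≡ 3`, `…ResConePowerCone`).  Along a shade-keeping step
`s →(j,b) s′` the contact form persists off the chart letter, `ℓ′ᵢ = λ ℓᵢ (i ≠ j)` (`…ResConeFormPersist`), and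
the only new datum is the TILT `ℓ′_j`.  `…ResConeLayerBirths` (p675208) identified every honest layer `m` of the
new cone with `c ×` the `x_j^{2m}`-layer `B_m` of the sheared residual polynomial `shear j b G`, `G = F / x^r`.
Reading layer `1` of `g′ = a′ · (λ L̃ + ℓ′_j x_j)^d` (`L̃ = Σ_{i ≠ j} ℓᵢ xᵢ`) against `B₁` gives:

* §1 linear-form calculus: `killVar_linearForm`, `pderiv_linearForm`, `coeff_add_single_C_mul_linearForm_pow`
  (`coeff_{μ+e_j} (a·L^n) = a·n·ℓ_j·coeff_μ (L̃^{n−1})` for `μ_j = 0`, via `∂_j` and `x_j ↦ 0`),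
  `linearForm_update_eq_C_mul`, `isHomogeneous_linearForm_pow`, `linearForm_update_pow_ne_zero`.
* §2 **`powerCone_tilt_identity`**: `a′ · d · ℓ′_j · λ^{d−1} · coeff_μ (L̃^{d−1}) = c · coeff_{μ + 2e_j} (shear j b G)`
  for every `x_j`-free `μ` of degree `d − 1` (band `q < o`, `o + 1 < 2q`; every `q`);
  **`powerCone_apply_self_eq_zero_iff`** (`1 ≤ d < p`, char `p`): NO TILT (`ℓ′_j = 0`) iff `B₁ = 0`;
  **`exists_births_eq_mul_of_powerCone_step`**: `B₁` is proportional to `L̃^{d−1}` (ALIGNMENT);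
  **`exists_births_eq_mul_of_finrank_step_eq_three`** / **`finrank_resVertex_step_le_two_of_births_not_aligned`**:
  from `resVertex s = ker ℓ` alone — if `e_G(s′) = 3` again then `B₁ ∝ L̃^{d−1}`; a misaligned birth layer forces
  `e_G(s′) ≤ 2` (EXIT from slice B).  So a power-cone stretch reads, per step, ONE scalar (the tilt, = `κ` up to
  the known factor `a′dλ^{d−1}/c`) and imposes a codimension-`(#{|μ| = d−1} − 1)` alignment on `G_{d+1}`.
Consumers: p-2 g3's `…ResConePowerChain` (one frame `ℓ_k, a_k, λ_k` per stretch) supplies `hg′`, `hlam`; the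
I-4-7 (TS) frame makes `B₁ ∝ L̃^{d−1}` automatic and the tilt the Tschirnhaus correction.
bears_on: LADDER-RESOLUTION:D157-DOOR2 (res-dim4-pi · K2(p) slice B · tilt law).  Supports
stmt-ResolutionOfSingularities-16155 (helper).
-/

set_option linter.dupNamespace false -- mandated namespace of this single-conjunct summit

noncomputable section

namespace Summit.ResolutionOfSingularities.ResolutionOfSingularities.Theorems.PIDim4

namespace ResCone

open MvPolynomial Finset
open Literature.AlgebraicGeometry.Resolution
open Literature.AlgebraicGeometry.Resolution.CentreBlowup
open Literature.AlgebraicGeometry.Resolution.Hauser2010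
open Literature.AlgebraicGeometry.Resolution.HauserPerlega2019
open PointBlowup (polarMap additiveSubspace direction)

variable {K : Type} [Field K]

/-! ## 1. Linear forms: the chart-letter-free part, the `x_j`-derivative, the layer `1` of a power -/

/-- `x_j ↦ 0` on a linear form kills the `x_j`-coefficient. [folklore] -/
theorem killVar_linearForm [DecidableEq K] (j : Fin 4) (ℓ : Fin 4 → K) :
    PointBlowup.killVar j (∑ i, C (ℓ i) * X i) = ∑ i, C (Function.update ℓ j 0 i) * X i := by
  unfold PointBlowup.killVar
  rw [map_sum]
  refine Finset.sum_congr rfl fun i _ => ?_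
  rw [map_mul, aeval_C, aeval_X, MvPolynomial.algebraMap_eq]
  by_cases hij : i = j
  · rw [if_pos hij, hij, Function.update_self, C_0, mul_zero, zero_mul]
  · rw [if_neg hij, Function.update_of_ne hij]

/-- `∂_j` of a linear form is its `x_j`-coefficient. [folklore] -/
theorem pderiv_linearForm (j : Fin 4) (ℓ : Fin 4 → K) : pderiv j (∑ i, C (ℓ i) * X i) = C (ℓ j) := by
  classical
  rw [map_sum, Finset.sum_eq_single j]
  · rw [pderiv_C_mul, pderiv_X, Pi.single_eq_same, mul_one]
  · intro i _ hij
    rw [pderiv_C_mul, pderiv_X, Pi.single_eq_of_ne hij, mul_zero]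
  · intro h; exact absurd (Finset.mem_univ j) h

/-- A polynomial fixed by `x_j ↦ 0` is `x_j`-free. [folklore] -/
theorem apply_eq_zero_of_killVar_eq [DecidableEq K] {j : Fin 4} {P : MvPolynomial (Fin 4) K}
    (h : PointBlowup.killVar j P = P) {e : Fin 4 →₀ ℕ} (he : e ∈ P.support) : e j = 0 := by
  by_contra hne
  have hc := MvPolynomial.mem_support_iff.mp he
  rw [← h, coeff_killVar, if_neg hne] at hc
  exact hc rfl

/-- Powers of the chart-letter-free linear form are `x_j`-free. [folklore] -/
theorem killVar_pow_linearForm_update [DecidableEq K] (j : Fin 4) (ℓ : Fin 4 → K) (n : ℕ) :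
    PointBlowup.killVar j ((∑ i, C (Function.update ℓ j 0 i) * X i) ^ n) =
      (∑ i, C (Function.update ℓ j 0 i) * X i) ^ n := by
  rw [map_pow, killVar_linearForm, Function.update_idem]

/-- Reading the layer `1` through `∂_j` and `x_j ↦ 0`: for `μ_j = 0`,
`coeff_{μ + e_j} P = coeff_μ ((∂_j P)|_{x_j = 0})`. [folklore] -/
theorem coeff_add_single_eq_coeff_killVar_pderiv [DecidableEq K] (j : Fin 4) (P : MvPolynomial (Fin 4) K)
    {μ : Fin 4 →₀ ℕ} (hμ : μ j = 0) :
    coeff (μ + Finsupp.single j 1) P = coeff μ (PointBlowup.killVar j (pderiv j P)) := by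
  rw [coeff_killVar, if_pos hμ, coeff_pderiv, hμ, Nat.cast_zero, zero_add, mul_one]

/-- **Layer `1` of `a · L^n`**: for `L = Σ ℓᵢ xᵢ`, `L̃ = L − ℓ_j x_j` and `μ_j = 0`,
`coeff_{μ + e_j} (a · L^n) = a · n · ℓ_j · coeff_μ (L̃^{n−1})`. [folklore] -/
theorem coeff_add_single_C_mul_linearForm_pow [DecidableEq K] (j : Fin 4) (ℓ : Fin 4 → K) (a : K) (n : ℕ)
    {μ : Fin 4 →₀ ℕ} (hμ : μ j = 0) :
    coeff (μ + Finsupp.single j 1) (C a * (∑ i, C (ℓ i) * X i) ^ n) =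
      a * n * ℓ j * coeff μ ((∑ i, C (Function.update ℓ j 0 i) * X i) ^ (n - 1)) := by
  rw [coeff_add_single_eq_coeff_killVar_pderiv j _ hμ, pderiv_C_mul, pderiv_pow, pderiv_linearForm,
    show C a * ((n : MvPolynomial (Fin 4) K) * (∑ i, C (ℓ i) * X i) ^ (n - 1) * C (ℓ j)) =
      C (a * n * ℓ j) * (∑ i, C (ℓ i) * X i) ^ (n - 1) by rw [C_mul, C_mul, map_natCast]; ring,
    map_mul, map_pow, killVar_linearForm]
  have hC : PointBlowup.killVar j (C (a * n * ℓ j)) = C (a * n * ℓ j) := by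
    rw [← MvPolynomial.algebraMap_eq]; exact (PointBlowup.killVar j).commutes _
  rw [hC, coeff_C_mul]

/-- Scaling the form off `j` scales the chart-letter-free part: if `ℓ′ᵢ = λ ℓᵢ` for `i ≠ j` then
`L̃′ = λ · L̃`. [folklore] -/
theorem linearForm_update_eq_C_mul (j : Fin 4) {ℓ ℓ' : Fin 4 → K} {lam : K}
    (h : ∀ i, i ≠ j → ℓ' i = lam * ℓ i) :
    (∑ i, C (Function.update ℓ' j 0 i) * X i : MvPolynomial (Fin 4) K) =
      C lam * ∑ i, C (Function.update ℓ j 0 i) * X i := by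
  rw [Finset.mul_sum]
  refine Finset.sum_congr rfl fun i _ => ?_
  by_cases hij : i = j
  · rw [hij]; simp
  · rw [Function.update_of_ne hij, Function.update_of_ne hij, h i hij, C_mul, mul_assoc]

/-- The chart-letter-free linear form is homogeneous of degree `1`, so its powers are homogeneous. [folklore] -/
theorem isHomogeneous_linearForm_pow (ℓ : Fin 4 → K) (n : ℕ) :
    ((∑ i, C (ℓ i) * X i : MvPolynomial (Fin 4) K) ^ n).IsHomogeneous n := by
  have h1 : (∑ i, C (ℓ i) * X i : MvPolynomial (Fin 4) K).IsHomogeneous 1 :=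
    MvPolynomial.IsHomogeneous.sum _ _ _ fun i _ => isHomogeneous_C_mul_X _ _
  simpa using h1.pow n

/-- A linear form with a non-zero coefficient off `j` has a non-zero chart-letter-free part, and so do its
powers. [folklore] -/
theorem linearForm_update_pow_ne_zero (j : Fin 4) {ℓ : Fin 4 → K} {i₀ : Fin 4} (hi₀j : i₀ ≠ j)
    (hi₀ : ℓ i₀ ≠ 0) (n : ℕ) :
    ((∑ i, C (Function.update ℓ j 0 i) * X i : MvPolynomial (Fin 4) K) ^ n) ≠ 0 := by
  refine pow_ne_zero n fun h => hi₀ ?_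
  have hc := congrArg (coeff (Finsupp.single i₀ 1)) h
  rw [coeff_sum, coeff_zero, Finset.sum_eq_single i₀] at hc
  · rwa [coeff_C_mul, coeff_X, if_pos rfl, mul_one, Function.update_of_ne hi₀j] at hc
  · intro i _ hi
    rw [coeff_C_mul, coeff_X, if_neg (fun h' => hi (Finsupp.single_left_injective one_ne_zero h')), mul_zero]
  · intro h'; exact absurd (Finset.mem_univ i₀) h'

/-- The scalar of a power-cone presentation `g = a · L^d` is non-zero. [folklore] -/
theorem ne_zero_of_resForm_eq_C_mul {s : State K} {o : ℕ} (ho : ordZero s.F = o)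
    (hr : ∀ d ∈ s.F.support, s.r ≤ d) {a : K} {P : MvPolynomial (Fin 4) K} (hg : resForm s = C a * P) :
    a ≠ 0 := by
  intro ha
  apply resForm_ne_zero ho hr
  rw [hg, ha, C_0, zero_mul]

/-! ## 2. The tilt law on a power-cone step -/

section Step

variable [DecidableEq K]

/-- **THE TILT IDENTITY** (slice B, layer `1`): at a shade-keeping band step `s →(j,b) s′` (`x^r ∣ F`,
`q < ord₀ F = o`, `o + 1 < 2q`, `b_j = 0`) whose NEW residual cone is a power cone `g′ = a′ · L′^d` with
`L′ = λ·L̃ + ℓ′_j x_j` off the chart letter (T-PERSIST), the tilt `ℓ′_j` satisfies, for every `x_j`-free `μ` of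
degree `d − 1`, `a′ · d · ℓ′_j · λ^{d−1} · coeff_μ (L̃^{d−1}) = c · coeff_{μ + 2e_j} (shear j b G)` — the
`x_j²`-layer of the sheared residual polynomial in degree `d + 1` (the birth layer `B₁` of
`…ResConeLayerBirths`). [OURS] [cite: CossartJannsenSaito2020, Thm. 3.10(4), Thm. 9.3] -/
theorem powerCone_tilt_identity {q : ℕ} (j : Fin 4) {b : Fin 4 → K} (hbj : b j = 0) {s : State K} {o : ℕ}
    (ho : ordZero s.F = o) (hr : ∀ d ∈ s.F.support, s.r ≤ d) (hqo : q < o) (ho2 : o + 1 < 2 * q)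
    (heq : (CentreBlowup.step q Finset.univ j b s).shade = s.shade) {ℓ ℓ' : Fin 4 → K} {a' lam : K}
    (hg' : resForm (CentreBlowup.step q Finset.univ j b s) =
      C a' * (∑ i, C (ℓ' i) * X i) ^ (o - s.r.degree))
    (hlam : ∀ i, i ≠ j → ℓ' i = lam * ℓ i) {μ : Fin 4 →₀ ℕ} (hμj : μ j = 0)
    (hμ : μ.degree + 1 = o - s.r.degree) :
    a' * ↑(o - s.r.degree) * ℓ' j * lam ^ (o - s.r.degree - 1) *
        coeff μ ((∑ i, C (Function.update ℓ j 0 i) * X i) ^ (o - s.r.degree - 1)) =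
      coeff (topMonomial j b s.r) (shear j b (monomial s.r (1 : K))) *
        coeff (μ + Finsupp.single j 2) (shear j b (s.F.divMonomial s.r)) := by
  -- layer `1` of `g′` read on the power-cone presentation …
  have h1 : coeff (μ + Finsupp.single j 1) (resForm (CentreBlowup.step q Finset.univ j b s)) =
      a' * ↑(o - s.r.degree) * ℓ' j *
        coeff μ ((∑ i, C (Function.update ℓ' j 0 i) * X i) ^ (o - s.r.degree - 1)) := by
    rw [hg', coeff_add_single_C_mul_linearForm_pow j ℓ' a' _ hμj]
  rw [linearForm_update_eq_C_mul j hlam, mul_pow, ← C_pow, coeff_C_mul] at h1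
  -- … and on the births
  have h2 := coeff_resForm_step_eq_mul_coeff_shear_divMonomial_of_add_lt j hbj ho hr hqo heq
    (μ := μ + Finsupp.single j 1) (by rw [map_add, Finsupp.degree_single]; exact hμ)
    (by rw [Finsupp.add_apply, hμj, Finsupp.single_eq_same]; omega)
  rw [Finsupp.add_apply, hμj, Finsupp.single_eq_same, zero_add, add_assoc, ← Finsupp.single_add, h1] at h2
  rw [← h2]
  ring

/-- **THE TILT CRITERION**: in the situation of `powerCone_tilt_identity` with `a′, λ ≠ 0`, `ℓ` alive off `j`
and `1 ≤ d < p`, the new contact form is UNTILTED (`ℓ′_j = 0`, `L′ = λ L̃`) iff the birth layer `B₁` vanishes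
(the sheared residual polynomial has no `x_j²`-monomials in degree `d + 1`). [OURS]
[cite: CossartJannsenSaito2020, Thm. 3.10(4), Thm. 9.3] -/
theorem powerCone_apply_self_eq_zero_iff (p : ℕ) [Fact p.Prime] [CharP K p] (j : Fin 4) {b : Fin 4 → K}
    (hbj : b j = 0) {s : State K} {o : ℕ} (ho : ordZero s.F = o) (hr : ∀ d ∈ s.F.support, s.r ≤ d)
    (hpo : p < o) (ho2 : o + 1 < 2 * p) (heq : (CentreBlowup.step p Finset.univ j b s).shade = s.shade)
    (hd1 : 1 ≤ o - s.r.degree) (hdp : o - s.r.degree < p) {ℓ ℓ' : Fin 4 → K} {a' lam : K}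
    (hg' : resForm (CentreBlowup.step p Finset.univ j b s) =
      C a' * (∑ i, C (ℓ' i) * X i) ^ (o - s.r.degree))
    (hlam : ∀ i, i ≠ j → ℓ' i = lam * ℓ i) (hlam0 : lam ≠ 0) (hℓ : ∃ i, i ≠ j ∧ ℓ i ≠ 0) :
    ℓ' j = 0 ↔ ∀ μ : Fin 4 →₀ ℕ, μ j = 0 → μ.degree + 1 = o - s.r.degree →
      coeff (μ + Finsupp.single j 2) (shear j b (s.F.divMonomial s.r)) = 0 := by
  have hc := coeff_topMonomial_ne_zero j hbj s.r
  constructor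
  · intro h0 μ hμj hμ
    have h := powerCone_tilt_identity j hbj ho hr hpo ho2 heq hg' hlam hμj hμ
    rw [h0, mul_zero, zero_mul, zero_mul] at h
    exact (mul_eq_zero.mp h.symm).resolve_left hc
  · intro hB
    obtain ⟨i₀, hi₀j, hi₀⟩ := hℓ
    -- a monomial of `L̃^{d−1}`
    have hne := linearForm_update_pow_ne_zero j hi₀j hi₀ (o - s.r.degree - 1)
    obtain ⟨μ, hμ⟩ := MvPolynomial.support_nonempty.mpr hne
    have hμj : μ j = 0 := apply_eq_zero_of_killVar_eq (killVar_pow_linearForm_update j ℓ _) hμ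
    have hμdeg : μ.degree + 1 = o - s.r.degree := by
      have h := isHomogeneous_linearForm_pow (Function.update ℓ j 0) (o - s.r.degree - 1)
        (MvPolynomial.mem_support_iff.mp hμ)
      rw [weight_one_eq_degree] at h
      omega
    have h := powerCone_tilt_identity j hbj ho hr hpo ho2 heq hg' hlam hμj hμdeg
    rw [hB μ hμj hμdeg, mul_zero] at h
    have ha' := ne_zero_of_resForm_eq_C_mul (ordZero_step_of_shade_eq j hbj ho hr heq)
      (newMult_le_of_mem_support_step p Finset.univ j b hbj s ho hr (perm_univ ho hr)) hg'
    have hd : ((o - s.r.degree : ℕ) : K) ≠ 0 := natCast_ne_zero_of_lt p hd1 hdp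
    rcases mul_eq_zero.mp h with h | h
    · rcases mul_eq_zero.mp h with h | h
      · rcases mul_eq_zero.mp h with h | h
        · rcases mul_eq_zero.mp h with h | h
          · exact absurd h ha'
          · exact absurd h hd
        · exact h
      · exact absurd h (pow_ne_zero _ hlam0)
    · exact absurd h (MvPolynomial.mem_support_iff.mp hμ)

/-- **ALIGNMENT OF THE BIRTH LAYER** (a necessary condition for the power cone to persist): in the situation of
`powerCone_tilt_identity` the birth layer `B₁` is PROPORTIONAL to `L̃^{d−1}` coefficientwise:
`∃ κ, coeff_{μ + 2e_j} (shear j b G) = κ · coeff_μ (L̃^{d−1})` for all `x_j`-free `μ` of degree `d − 1`.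
[OURS] [cite: CossartJannsenSaito2020, Thm. 3.10(4), Thm. 9.3] -/
theorem exists_births_eq_mul_of_powerCone_step {q : ℕ} (j : Fin 4) {b : Fin 4 → K} (hbj : b j = 0)
    {s : State K} {o : ℕ} (ho : ordZero s.F = o) (hr : ∀ d ∈ s.F.support, s.r ≤ d) (hqo : q < o)
    (ho2 : o + 1 < 2 * q) (heq : (CentreBlowup.step q Finset.univ j b s).shade = s.shade)
    {ℓ ℓ' : Fin 4 → K} {a' lam : K}
    (hg' : resForm (CentreBlowup.step q Finset.univ j b s) =
      C a' * (∑ i, C (ℓ' i) * X i) ^ (o - s.r.degree))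
    (hlam : ∀ i, i ≠ j → ℓ' i = lam * ℓ i) :
    ∃ κ : K, ∀ μ : Fin 4 →₀ ℕ, μ j = 0 → μ.degree + 1 = o - s.r.degree →
      coeff (μ + Finsupp.single j 2) (shear j b (s.F.divMonomial s.r)) =
        κ * coeff μ ((∑ i, C (Function.update ℓ j 0 i) * X i) ^ (o - s.r.degree - 1)) := by
  have hc := coeff_topMonomial_ne_zero j hbj s.r
  refine ⟨a' * ↑(o - s.r.degree) * ℓ' j * lam ^ (o - s.r.degree - 1) /
    coeff (topMonomial j b s.r) (shear j b (monomial s.r (1 : K))), fun μ hμj hμ => ?_⟩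
  have h := powerCone_tilt_identity j hbj ho hr hqo ho2 heq hg' hlam hμj hμ
  rw [div_mul_eq_mul_div, eq_div_iff hc, h, mul_comm]

/-- **THE POWER CONE PERSISTS ONLY THROUGH AN ALIGNED BIRTH LAYER** (slice B exit criterion, `q = p` prime,
`K` of characteristic `p`): at a shade-keeping band step from a state with hyperplane vertex `resVertex s = ker ℓ`
(`ℓ ≠ 0`, so `e_G = 3`) and `d = o − |r| < p`, if the new state again has `e_G = 3` then the birth layer `B₁`
is proportional to `L̃^{d−1}` (`…PowerCone` at `s′` + T-PERSIST `…FormPersist` + the tilt identity). [OURS]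
[cite: CossartJannsenSaito2020, Thm. 3.10(4), Thm. 3.14, Thm. 9.3] -/
theorem exists_births_eq_mul_of_finrank_step_eq_three (p : ℕ) [Fact p.Prime] [CharP K p] (j : Fin 4)
    {b : Fin 4 → K} (hbj : b j = 0) {s : State K} {o : ℕ} (ho : ordZero s.F = o)
    (hr : ∀ d ∈ s.F.support, s.r ≤ d) (hpo : p < o) (ho2 : o + 1 < 2 * p)
    (heq : (CentreBlowup.step p Finset.univ j b s).shade = s.shade) (hdp : o - s.r.degree < p)
    {ℓ : Fin 4 → K} (hV : ∀ w, w ∈ resVertex s ↔ dotProduct ℓ w = 0) (hℓ : ℓ ≠ 0)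
    (he' : Module.finrank K (resVertex (CentreBlowup.step p Finset.univ j b s)) = 3) :
    ∃ κ : K, ∀ μ : Fin 4 →₀ ℕ, μ j = 0 → μ.degree + 1 = o - s.r.degree →
      coeff (μ + Finsupp.single j 2) (shear j b (s.F.divMonomial s.r)) =
        κ * coeff μ ((∑ i, C (Function.update ℓ j 0 i) * X i) ^ (o - s.r.degree - 1)) := by
  have ho' := ordZero_step_of_shade_eq j hbj ho hr heq
  have hd' : (CentreBlowup.step p Finset.univ j b s).r.degree + (o - s.r.degree) -
      (CentreBlowup.step p Finset.univ j b s).r.degree = o - s.r.degree := Nat.add_sub_cancel_left ..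
  obtain ⟨ℓ', a', hℓ', hV', hg'⟩ := resForm_eq_C_mul_pow_of_finrank_eq_three p ho' (by rw [hd']; exact hdp) he'
  rw [hd'] at hg'
  obtain ⟨lam, -, hlam⟩ := linearForm_step_proportional_off_chart j hbj ho hr hpo (by omega) heq hV
    (fun w => hV' w) hℓ
  exact exists_births_eq_mul_of_powerCone_step j hbj ho hr hpo ho2 heq hg' hlam

/-- Contrapositive: **a misaligned birth layer drops the vertex** — if `B₁` is not proportional to `L̃^{d−1}`,
then `e_G(s′) ≤ 2` (the chain has left slice B). [OURS]
[cite: CossartJannsenSaito2020, Thm. 3.10(4), Thm. 3.14, Thm. 9.3] -/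
theorem finrank_resVertex_step_le_two_of_births_not_aligned (p : ℕ) [Fact p.Prime] [CharP K p] (j : Fin 4)
    {b : Fin 4 → K} (hbj : b j = 0) {s : State K} {o : ℕ} (ho : ordZero s.F = o)
    (hr : ∀ d ∈ s.F.support, s.r ≤ d) (hpo : p < o) (ho2 : o + 1 < 2 * p)
    (heq : (CentreBlowup.step p Finset.univ j b s).shade = s.shade) (hdp : o - s.r.degree < p)
    {ℓ : Fin 4 → K} (hV : ∀ w, w ∈ resVertex s ↔ dotProduct ℓ w = 0) (hℓ : ℓ ≠ 0)
    (he : Module.finrank K (resVertex s) = 3)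
    (hB : ¬ ∃ κ : K, ∀ μ : Fin 4 →₀ ℕ, μ j = 0 → μ.degree + 1 = o - s.r.degree →
      coeff (μ + Finsupp.single j 2) (shear j b (s.F.divMonomial s.r)) =
        κ * coeff μ ((∑ i, C (Function.update ℓ j 0 i) * X i) ^ (o - s.r.degree - 1))) :
    Module.finrank K (resVertex (CentreBlowup.step p Finset.univ j b s)) ≤ 2 := by
  have hle := finrank_resVertex_step_le j hbj ho hr hpo (by omega) heq
  rw [he] at hle
  rcases hle.lt_or_eq with hlt | h3
  · omega
  · exact absurd (exists_births_eq_mul_of_finrank_step_eq_three p j hbj ho hr hpo ho2 heq hdp hV hℓ h3) hB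

end Step

end ResCone

end Summit.ResolutionOfSingularities.ResolutionOfSingularities.Theorems.PIDim4

end
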